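import Mathlib
import Literature.Probability.Percolation.PercolationProofs
import Literature.Probability.LatticeModels.ProdBernoulliIndependence
import Literature.Probability.Percolation.KozmaNitzanPinning
import Summits.CriticalPhenomena.PercolationContinuityZ3.Theorems.PercNearOneGluingNoHeavyLowerTailFatMinorityMovingAnchorCertificate
import Summits.CriticalPhenomena.PercolationContinuityZ3.Theorems.PercNearOneGluingNoHeavyLowerTailFatMinorityOneLayerOrdered
import HarnessLib

/-!
# `NoHeavyLowerTail` (stmt-CriticalPhenomena-4575), line fat-minority-linear — the CERTIFIED MOVING ANCHOR:
# an unconditional linear gluing bound for one-layer observers from the glued-piece framework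

Route task `nh-dp-fatminority` (gen 5).  One-layer observer `o` (private units `X`, coins arbitrary),
relays `A ∋ b`; `ν_B = prodBernoulli (pinW w (coins ∪ B×A) ∅)` for a fired set `B ⊆ X` (`G ∖ o` with
the attachments of `B` deleted).
* `oneLayer_movingAnchor` — for any set `𝒜 ⊆ A` containing, for every nonempty `B ⊆ X`, a minimiser of
  `ν_B(· ↔ b)` over `A`:  `μ(o ↔ A, o ↮ b) ≤ ∑_{a ∈ 𝒜} μ(o ↔ A, a ↮ b)` (`…_bad_le`: `≤ ∑_{a∈𝒜} μ(a ↮ b)`),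
  i.e. linear gluing with constant `|𝒜|` = the number of distinct Kozma–Nitzan "moving anchors" and NO
  `μ(o ↮ A)` term.  Proof: `oneLayer_orderedAnchor_family` + `movingAnchor_certificate`.
* `oneLayer_stableAnchor` — a single minimiser for all `B`: Kozma–Nitzan's pre-FKG inequality (41) with
  constant `1` for the observer.
Relation to gen 1's moving-anchor bound `oneLayer_notConn_le_movingAnchor` (`…FatMinorityMovingAnchor`,
MAB = `Σ_S ℓ_S P'_S(a_S ↮ b)`): grouping its layers by anchor also gives `bad ≤ μ(o ↮ A) + |𝒜|·max μ(a↮b)`;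
the present route reaches the same anchors through the FIXED-anchor certificate machinery (per-row
ranks, glued comparisons), drops the `μ(o ↮ A)` term, and is the unconditional base case of the
conditional `C = 1` theorems `oneLayer_orderedAnchor_pre/_family` (`FINDINGS-fat-minority-gen5.md` §8–11).
UNCONDITIONAL; no new definitions.
-/


namespace Summit.CriticalPhenomena.PercolationContinuityZ3.Theorems

open MeasureTheory Set
open Literature.Probability.LatticeModels (prodBernoulli)
open Literature.Probability.Percolation (BondConfig openConn openGraph openGraph_adj openEdgeCluster)
open scoped BigOperators

noncomputable section
open Classical
open Literature.Probability.LatticeModels Literature.Probability.Percolation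

variable {n : ℕ}

/-- **Kozma–Nitzan's moving anchor, one-layer observers (UNCONDITIONAL linear gluing bound).**
`o ∉ A ∋ b`; every positive-weight neighbour of `o` is a private unit (`X` = units, `K` = coins); `𝒜 ⊆ A`
nonempty contains, for every nonempty fired set `B ⊆ X`, a minimiser over `A` of `ν_B(· ↔ b)`,
`ν_B = prodBernoulli (pinW w (K ∪ B×A) ∅)` (`G ∖ o` with the attachments of `B` deleted).  Then
`μ(o ↔ A, o ↮ b) ≤ ∑_{a ∈ 𝒜} μ(o ↔ A, a ↮ b)`; with `|𝒜| = 1` this is the pre-FKG inequality (41) with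
constant `1` (Kozma–Nitzan's Theorems 4–5 are `|X| ≤ 1`).
[cite: KozmaNitzan2024, §3.2 Theorems 4–5 (p. 13), Lemma 5 (p. 13), Question 9 (p. 36)] -/
theorem oneLayer_movingAnchor (w : Sym2 (Fin n) → unitInterval) (A 𝒜 : Finset (Fin n)) (o b : Fin n)
    (hoA : o ∉ A) (hb : b ∈ A) (h𝒜 : 𝒜 ⊆ A) (h𝒜ne : 𝒜.Nonempty)
    (hX : ∀ y : Fin n, y ≠ o → w s(o, y) ≠ 0 → y ∉ A ∧ ∀ z : Fin n, z ≠ o → z ∉ A → w s(y, z) = 0)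
    (hmin : ∀ B : Finset (Fin n), B ⊆ (Finset.univ.filter fun y : Fin n => y ≠ o ∧ w s(o, y) ≠ 0) →
      B.Nonempty → ∃ a ∈ 𝒜, ∀ c ∈ A,
        (prodBernoulli (pinW w
          ((↑((Finset.univ.filter fun y : Fin n => y ≠ o ∧ w s(o, y) ≠ 0).image fun y => s(o, y)) :
              Set (Sym2 (Fin n))) ∪ ↑((B ×ˢ A).image fun p => s(p.1, p.2))) ∅)).real (openConn a b) ≤
        (prodBernoulli (pinW w
          ((↑((Finset.univ.filter fun y : Fin n => y ≠ o ∧ w s(o, y) ≠ 0).image fun y => s(o, y)) :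
              Set (Sym2 (Fin n))) ∪ ↑((B ×ˢ A).image fun p => s(p.1, p.2))) ∅)).real (openConn c b)) :
    (prodBernoulli w).real ((⋃ c ∈ A, openConn o c) ∩ (openConn o b)ᶜ) ≤
      ∑ a ∈ 𝒜, (prodBernoulli w).real ((⋃ c ∈ A, openConn o c) ∩ (openConn a b)ᶜ) := by
  set X : Finset (Fin n) := Finset.univ.filter fun y : Fin n => y ≠ o ∧ w s(o, y) ≠ 0 with hXdef
  have hXunit : ∀ y ∈ X, y ≠ o ∧ w s(o, y) ≠ 0 := fun y hy => (Finset.mem_filter.1 hy).2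
  have hoX : o ∉ X := fun h => (hXunit o h).1 rfl
  have hXA : Disjoint X A := by
    rw [Finset.disjoint_left]
    intro y hy
    exact (hX y (hXunit y hy).1 (hXunit y hy).2).1
  have hstar0 : ∀ y : Fin n, y ≠ o → y ∉ X → w s(o, y) = 0 := by
    intro y hyo hyX
    by_contra h
    exact hyX (Finset.mem_filter.2 ⟨Finset.mem_univ _, hyo, h⟩)
  have hunit : ∀ y ∈ X, ∀ z : Fin n, z ≠ o → z ∉ A → w s(y, z) = 0 :=
    fun y hy z hzo hzA => (hX y (hXunit y hy).1 (hXunit y hy).2).2 z hzo hzA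
  have hinj : Set.InjOn (fun v : Fin n => (v : ℕ)) ↑A := fun u _ v _ h => Fin.ext h
  refine oneLayer_orderedAnchor_family w A 𝒜 o b hoA hb h𝒜 hX ?_
  intro B hBX
  by_cases hBne : B.Nonempty
  · obtain ⟨a, ha𝒜, hmin'⟩ := hmin B hBX hBne
    refine ⟨a, ha𝒜, fun v : Fin n => (v : ℕ), hinj, ?_⟩
    intro c hc _ _ x hx _
    exact movingAnchor_certificate w X B A o a b c x (fun v : Fin n => (v : ℕ)) hinj hoX hoA hBX hXA
      hstar0 hunit (h𝒜 ha𝒜) hc hb hx (hmin' c hc)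
  · obtain ⟨a, ha⟩ := h𝒜ne
    refine ⟨a, ha, fun v : Fin n => (v : ℕ), hinj, ?_⟩
    intro c _ _ _ x hx
    exact absurd ⟨x, hx⟩ hBne

/-- **Bad form.**  Under the hypotheses of `oneLayer_movingAnchor`,
`μ(o ↔ A, o ↮ b) ≤ ∑_{a ∈ 𝒜} μ(a ↮ b) ≤ |𝒜| · max_{a} μ(a ↮ b)`: linear gluing with constant `|𝒜|`
(the number of distinct moving anchors) and no `μ(o ↮ A)` term.
[cite: KozmaNitzan2024, §3.2 Theorems 4–5 (p. 13)] -/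
theorem oneLayer_movingAnchor_bad_le (w : Sym2 (Fin n) → unitInterval) (A 𝒜 : Finset (Fin n)) (o b : Fin n)
    (hoA : o ∉ A) (hb : b ∈ A) (h𝒜 : 𝒜 ⊆ A) (h𝒜ne : 𝒜.Nonempty)
    (hX : ∀ y : Fin n, y ≠ o → w s(o, y) ≠ 0 → y ∉ A ∧ ∀ z : Fin n, z ≠ o → z ∉ A → w s(y, z) = 0)
    (hmin : ∀ B : Finset (Fin n), B ⊆ (Finset.univ.filter fun y : Fin n => y ≠ o ∧ w s(o, y) ≠ 0) →
      B.Nonempty → ∃ a ∈ 𝒜, ∀ c ∈ A,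
        (prodBernoulli (pinW w
          ((↑((Finset.univ.filter fun y : Fin n => y ≠ o ∧ w s(o, y) ≠ 0).image fun y => s(o, y)) :
              Set (Sym2 (Fin n))) ∪ ↑((B ×ˢ A).image fun p => s(p.1, p.2))) ∅)).real (openConn a b) ≤
        (prodBernoulli (pinW w
          ((↑((Finset.univ.filter fun y : Fin n => y ≠ o ∧ w s(o, y) ≠ 0).image fun y => s(o, y)) :
              Set (Sym2 (Fin n))) ∪ ↑((B ×ˢ A).image fun p => s(p.1, p.2))) ∅)).real (openConn c b)) :
    (prodBernoulli w).real ((⋃ c ∈ A, openConn o c) ∩ (openConn o b)ᶜ) ≤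
      ∑ a ∈ 𝒜, (prodBernoulli w).real (openConn a b)ᶜ :=
  (oneLayer_movingAnchor w A 𝒜 o b hoA hb h𝒜 h𝒜ne hX hmin).trans
    (Finset.sum_le_sum fun _ _ => measureReal_mono Set.inter_subset_right (measure_ne_top _ _))


/-- **Stable anchor ⟹ constant 1 (Kozma–Nitzan's pre-FKG inequality (41) for one-layer observers).**  If
one relay `a` minimises `ν_B(· ↔ b)` for EVERY nonempty fired set `B` (KN's deleted-graph anchor does not
move), then `μ(o ↔ A, o ↮ b) ≤ μ(o ↔ A, a ↮ b) ≤ μ(a ↮ b)`.  Kozma–Nitzan's Theorems 4–5 are the cases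
`|X| ≤ 1`. [cite: KozmaNitzan2024, §3.2 Theorems 4–5 (p. 13), Question 9 (p. 36)] -/
theorem oneLayer_stableAnchor (w : Sym2 (Fin n) → unitInterval) (A : Finset (Fin n)) (o a b : Fin n)
    (hoA : o ∉ A) (hb : b ∈ A) (ha : a ∈ A)
    (hX : ∀ y : Fin n, y ≠ o → w s(o, y) ≠ 0 → y ∉ A ∧ ∀ z : Fin n, z ≠ o → z ∉ A → w s(y, z) = 0)
    (hmin : ∀ B : Finset (Fin n), B ⊆ (Finset.univ.filter fun y : Fin n => y ≠ o ∧ w s(o, y) ≠ 0) →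
      B.Nonempty → ∀ c ∈ A,
        (prodBernoulli (pinW w
          ((↑((Finset.univ.filter fun y : Fin n => y ≠ o ∧ w s(o, y) ≠ 0).image fun y => s(o, y)) :
              Set (Sym2 (Fin n))) ∪ ↑((B ×ˢ A).image fun p => s(p.1, p.2))) ∅)).real (openConn a b) ≤
        (prodBernoulli (pinW w
          ((↑((Finset.univ.filter fun y : Fin n => y ≠ o ∧ w s(o, y) ≠ 0).image fun y => s(o, y)) :
              Set (Sym2 (Fin n))) ∪ ↑((B ×ˢ A).image fun p => s(p.1, p.2))) ∅)).real (openConn c b)) :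
    (prodBernoulli w).real ((⋃ c ∈ A, openConn o c) ∩ (openConn o b)ᶜ) ≤
      (prodBernoulli w).real ((⋃ c ∈ A, openConn o c) ∩ (openConn a b)ᶜ) := by
  rw [← Finset.sum_singleton (fun a' : Fin n =>
    (prodBernoulli w).real ((⋃ c ∈ A, openConn o c) ∩ (openConn a' b)ᶜ)) a]
  exact oneLayer_movingAnchor w A {a} o b hoA hb (Finset.singleton_subset_iff.2 ha)
    (Finset.singleton_nonempty a) hX (fun B hB hBne => ⟨a, Finset.mem_singleton_self a, hmin B hB hBne⟩)

end

end Summit.CriticalPhenomena.PercolationContinuityZ3.Theorems
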